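import Summits.QuantumFields.YangMills.Theorems.BalabanUVNodesPortS1QtCHol
import Summits.QuantumFields.YangMills.Theorems.BalabanUVNodesC44IterMhOneStep
import Summits.QuantumFields.BalabanUV.Beta.LinearizingChange267FromQ

/-!
# NODE O port PT-A — socket (o1) «D̃», leaf (o1-β)₂: THE QUANTITATIVE HALF — `QuadAnalytic (recordCtC F k K Vk) C₂ R` WITH `C₂, R` DEPENDING ON `d, L` ONLY ([I] p.267 «there exists exactly one solution … an
# analytic function of B … D̃⁽²⁾ = C̃⁽²⁾»: the INPUT `QuadAnalytic Ct C₂ R` of lit's ✓`B12Lineariz267.exists_Dt`, at ★★ DEF-1's complexified constraint ✓`…K0RecordFormatNamesFluctQtC`), for every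
# background `V^{(k)}` whose (0.4) loop matrices are within `ε ≤ 1∕50` of `1` and which sits inside the (0.4) guard — PT-B's one-step loop∕re-gauge estimates (✓`C44IterMh.norm_loopMh_sub_one_le`,
# ✓`exists_regauge`) give the loop polydisc and the series-log window on the sup-norm ball `‖z‖ < 1∕(10⁸·d·L)`, the sup bound `‖Q̃_ℂ‖ ≤ 1` there, and ✓`LinearizingChange267FromQ.nonlin_sq_bound` (Cauchy) the
# quadratic onset `‖C̃(z)‖ ≤ (2∕R²)‖z‖²`

Cell `ym-nodeO-ideate`, porter seat `ymgap-nodeO-port-PTA-1` (gen 9); `--kind proof --supports stmt-QuantumFields-27930 --as helper` (FIBRE-CHART-LAW-v1 row (L3-c); ★★ DEF-1 g39 15:26:19Z word; sequel of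
✓`…PortS1QtCHol` (o1-β)₁).  [I] = [Balaban1987RG1]; [B7] = [Balaban1985Averaging]; [15] = [Balaban1985Variational].

CONTENT (theorems only; no `def`, no `instance`, no `sorry`):
* §1 ★★ `windows_of_oneStep` — in PT-B's currency (`s, φ, λ, ε` with `φ + λ ≤ 10⁻⁶`, `ε ≤ 1∕50`, the (0.4) guard at `V^{(k)}`): for the complex field `pertC Vk z` with `‖pertC Vk z b·(↑Vk b)⋆ − 1‖ ≤ s`,
  (a) every loop matrix is within `7(φ+λ)+ε` of `1`, (b) `‖M_h(Ṽ)(c)·Ū(Vk)(c)⋆ − 1‖ ≤ 1∕2`, hence (c) `‖recordQtC Vk z c‖ ≤ 1`.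
* §2 `phi_add_lam_le_of_norm_le` — the radius: `‖z‖ ≤ 1∕(10⁸·d·L)` ⇒ with `s := e^{3‖z‖} − 1`, `(1+2s)^{dL} − 1 + (1+2s)^L − 1 ≤ 10⁻⁶`.
* §3 ★★★ `quadAnalytic_recordCtC` — `QuadAnalytic (recordCtC F k K Vk) (2 ∕ R²) R`, `R = 1∕(10⁸·d·L)`, for every loop-`ε`-small guarded `Vk`; with `differentiableOn_recordQtC_ball`, `norm_recordQtC_le_one`,
  `recordQtC_zero_fun`, `nonlin_recordQtC` (`rfl`: lit's `nonlin (recordQtC Vk) = recordCtC Vk`).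

HONEST FRAMING.  Elementary assembly of PT-B's PROVED one-step estimates (their (ℓa-C) road, [B7] Prop. 3 content) and lit's Cauchy remainder over DEF-1's definitions; crude explicit constants; this is the
ESTIMATE input of socket (o1) — `exists_Dt` itself ((o1-ε)) still needs the ℂ-linear `h` (`hopLinGraphC`, DEF-1) with its bound ((o1-δ)), and ◆'s (R-k) bridges are (o1-β)₃; nothing of Bałaban's
renormalization-group estimates beyond this transport is asserted, ported or discharged; `stub_P0C` ∕ `stub_FE` OPEN; ⟨27930⟩ ⁸-Ax-LR4 OPEN · no claim; NODE O 0∕1; COUNT 8∕28 · K 1∕4 UNMOVED; finite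
`𝕋⁴_{L^K}` at fixed ε — NOT continuum ∕ OS ∕ Clay; **the Yang–Mills mass gap is NOT proved by any of this.**  Standard axioms.
-/

noncomputable section

open scoped BigOperators Matrix.Norms.L2Operator
open Set Metric

namespace Summit.QuantumFields.YangMills.Theorems.BalabanUVNodesPortS1

open Literature.MathematicalPhysics.QuantumFieldTheory.Balaban1983to89
open Literature.MathematicalPhysics.QuantumFieldTheory.Balaban1983to89.Node00
open Literature.MathematicalPhysics.QuantumFieldTheory.Balaban1983to89.T4Continuum (T4Family)
open Literature.MathematicalPhysics.QuantumFieldTheory.Balaban1983to89.B15AveragingHolomorphic (avgMh loopMh coe_avgFun_eq_avgMh)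
open Summit.QuantumFields.YangMills.Theorems.K0RecordFormatNames (su2Gen FluctIdx fluctMatC pertC recordQtC recordQtC_apply recordQtC_zero recordLQtC recordCtC)
open Summit.QuantumFields.YangMills.Theorems.C44IterMh (norm_loopMh_sub_one_le exists_regauge norm_inv_sub_one_le_of_det norm_unitary_conj_sub_one_eq norm_mul_sub_one_le_of_le₂)
open Summit.QuantumFields.BalabanUV.Beta.LinearizingChange267FromQ (nonlin nonlin_sq_bound)
open BlockAveraging (Small Idx)
open ExpMeanLog (expMeanLogSU)
open B13Contraction113 (QuadAnalytic)

variable (F : T4Family)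

/-! ## §1  The loop polydisc and the series-log window, in PT-B's one-step currency -/

/-- ★★ **THE TWO WINDOWS OF `Q̃_ℂ` FROM PT-B's ONE-STEP ESTIMATES.**  Background `Vk` with (0.4) loops `ε`-close to `1` (`ε ≤ 1∕50`) inside the (0.4) guard at `c`; complex field `Ṽ = pertC Vk z` with
`‖Ṽ(b)·Vk(b)⋆ − 1‖ ≤ s` and PT-B's staircase∕segment sizes `φ ≥ (1+2s)^{dL} − 1`, `λ ≥ (1+2s)^L − 1`, `φ + λ ≤ 10⁻⁶`.  Then (a) `‖Ṽ(loop_i) − 1‖ ≤ 7(φ+λ) + ε` for every loop index, and (b)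
`‖M_h(Ṽ)(c) · Ū(Vk)(c)⋆ − 1‖ ≤ 1∕2` (re-gauge `M_h(Ṽ)(c) = H(c₋)·Ṽ′(c)·H(c₊)⁻¹`, `‖H − 1‖ ≤ 2φ`, `‖Ṽ′(c)·M_h(Vk)(c)⋆ − 1‖ ≤ (1+s)^L − 1 + 1.2·10⁶(φ+λ)² + 1.3·10⁴ε(φ+λ)`, unitary conjugation).
[cite: Balaban1985Averaging, (47) p.25, Proposition 3 p.36; Balaban1987RG1, (0.4)–(0.8) p.253, (2.4) p.266] -/
theorem windows_of_oneStep (k K : ℕ) (hk : k + 1 ≤ (F.P K).m + (F.P K).K) (Vk : GaugeField (F.P K) k (SU 2)) (z : FluctIdx F k K → ℂ) {s φ lam ε : ℝ}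
    (hs : ∀ b, ‖pertC F k K Vk z b * star (Vk b : MatA 2) - 1‖ ≤ s) (hφ : (1 + 2 * s) ^ ((F.P K).d * (F.P K).L) - 1 ≤ φ) (hlam : (1 + 2 * s) ^ (F.P K).L - 1 ≤ lam)
    (hε : ∀ (c : PBond (F.P K) (k + 1)) (i : Idx (F.P K)), ‖loopM (coeField Vk) c i - 1‖ ≤ ε) (hκ : φ + lam ≤ 1 / 10 ^ 6) (hε50 : ε ≤ 1 / 50)
    (c : PBond (F.P K) (k + 1)) (hVk : Small expMeanLogSU Vk c) :
    (∀ i : Idx (F.P K), ‖loopMh (pertC F k K Vk z) c i - 1‖ ≤ 7 * (φ + lam) + ε) ∧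
      ‖avgMh (pertC F k K Vk z) c * star (((avOfRecord F 2 K k).avg Vk c : SU 2) : MatA 2) - 1‖ ≤ 1 / 2 := by
  have _ := hk
  -- scalars
  have hs0 : 0 ≤ s := by
    exact (norm_nonneg _).trans (hs (K0RecordFormatNames.recordB0 F k K c))
  have h1s : (1 : ℝ) ≤ 1 + 2 * s := by linarith
  have hφ0 : 0 ≤ φ := le_trans (by linarith [one_le_pow₀ h1s (n := (F.P K).d * (F.P K).L)]) hφ
  have hlam0 : 0 ≤ lam := le_trans (by linarith [one_le_pow₀ h1s (n := (F.P K).L)]) hlam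
  have hκ1 : φ + lam ≤ 1 / 1000000 := hκ.trans (by norm_num)
  have hε0 : 0 ≤ ε := (norm_nonneg _).trans (hε c (Classical.arbitrary _))
  -- `s ≤ 1/2`: Bernoulli `1 + L·(2s) ≤ (1+2s)^L ≤ 1 + lam`
  have hs2 : s ≤ 1 / 2 := by
    have hB := one_add_mul_le_pow (show (-2 : ℝ) ≤ 2 * s by linarith) (F.P K).L
    have hL1 : (1 : ℝ) ≤ (F.P K).L := by exact_mod_cast (F.P K).hL.2.le
    nlinarith
  have hφ2 : φ ≤ 1 / 2 := by linarith
  have hlam2 : lam ≤ 1 / 2 := by linarith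
  have hσ : 3 * φ + 3 * lam ≤ 1 := by linarith
  have hε6 : ε ≤ 1 / 6 := by linarith
  have hN : ((2 : ℕ) : ℝ) * (7 * (φ + lam) + ε) ≤ 3 := by push_cast; linarith
  have hdet : ∀ b, (pertC F k K Vk z b).det = 1 := det_pertC F k K Vk z
  refine ⟨fun i => norm_loopMh_sub_one_le Vk hdet hs hs2 hφ hlam hφ2 hlam2 hσ hε hε6 c i, ?_⟩
  -- (b): re-gauge
  obtain ⟨H, V', hHdet, hH, havg, hV'det, hV'⟩ := exists_regauge Vk hdet hs hφ hlam hε hκ hε50 hN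
  set A : MatA 2 := (((avOfRecord F 2 K k).avg Vk c : SU 2) : MatA 2) with hA
  have hAu : A ∈ Matrix.unitaryGroup (Fin 2) ℂ := ((avOfRecord F 2 K k).avg Vk c).2.1
  have hAcoe : avgMh (coeField Vk) c = A := (coe_avgFun_eq_avgMh Vk c hVk).symm
  -- sizes
  have hτ := hV' c
  rw [hAcoe] at hτ
  set τ : ℝ := ((1 + s) ^ (F.P K).L - 1) + 1200000 * (φ + lam) ^ 2 + 13000 * ε * (φ + lam) with hτdef
  have hτ0 : 0 ≤ τ := (norm_nonneg _).trans hτ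
  have hτle : τ ≤ 1 / 100 := by
    have h1 : (1 + s) ^ (F.P K).L - 1 ≤ lam := by
      have : (1 + s) ^ (F.P K).L ≤ (1 + 2 * s) ^ (F.P K).L := pow_le_pow_left₀ (by linarith) (by linarith) _
      linarith
    have h2 : (φ + lam) ^ 2 ≤ (φ + lam) * (1 / 1000000) := by
      rw [sq]; exact mul_le_mul_of_nonneg_left hκ1 (by linarith)
    have h3 : 13000 * ε * (φ + lam) ≤ 13000 * (1 / 50) * (1 / 1000000) := by
      apply mul_le_mul (mul_le_mul_of_nonneg_left hε50 (by norm_num)) hκ1 (by linarith) (by positivity)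
    rw [hτdef]; nlinarith
  -- the inverse gauge factor conjugated by the unitary `A`
  have hHinv : ‖(H c.tgt)⁻¹ - 1‖ ≤ 2 * (2 * φ) :=
    norm_inv_sub_one_le_of_det (C44IterMh.sl_isUnit_det (hHdet c.tgt)) (hH c.tgt) (by linarith)
  have hconj : ‖A * (H c.tgt)⁻¹ * star A - 1‖ ≤ 4 * φ := by
    rw [norm_unitary_conj_sub_one_eq hAu]; linarith
  -- `V' = (V'·A⋆)·A`
  have hV'eq : V' c = (V' c * star A) * A := by
    rw [mul_assoc, (Matrix.mem_unitaryGroup_iff').1 hAu, mul_one]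
  -- assemble: X = H₁ · (V'A⋆) · (A H₂⁻¹ A⋆)
  have hX : avgMh (pertC F k K Vk z) c * star A = H c.src * (V' c * star A) * (A * (H c.tgt)⁻¹ * star A) := by
    rw [havg c]
    conv_lhs => rw [hV'eq]
    simp only [mul_assoc]
  rw [hX]
  have h12 := norm_mul_sub_one_le_of_le₂ (hH c.src) hτ
  have h123 := norm_mul_sub_one_le_of_le₂ h12 hconj
  refine h123.trans ?_
  nlinarith [mul_nonneg hφ0 hτ0, mul_nonneg hφ0 hφ0, mul_nonneg (mul_nonneg hφ0 hτ0) hφ0]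

/-- Consequence (c): inside the windows `‖Q̃_ℂ(Vk; z)(c)‖ ≤ 1` (`‖mlog X‖ ≤ 2‖X − 1‖` for `‖X − 1‖ ≤ 1∕2`). [cite: Balaban1985Averaging, (21) p.21; Balaban1987RG1, p.267] -/
theorem norm_recordQtC_apply_le_one (k K : ℕ) (hk : k + 1 ≤ (F.P K).m + (F.P K).K) (Vk : GaugeField (F.P K) k (SU 2)) (z : FluctIdx F k K → ℂ) {s φ lam ε : ℝ}
    (hs : ∀ b, ‖pertC F k K Vk z b * star (Vk b : MatA 2) - 1‖ ≤ s) (hφ : (1 + 2 * s) ^ ((F.P K).d * (F.P K).L) - 1 ≤ φ) (hlam : (1 + 2 * s) ^ (F.P K).L - 1 ≤ lam)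
    (hε : ∀ (c : PBond (F.P K) (k + 1)) (i : Idx (F.P K)), ‖loopM (coeField Vk) c i - 1‖ ≤ ε) (hκ : φ + lam ≤ 1 / 10 ^ 6) (hε50 : ε ≤ 1 / 50)
    (c : PBond (F.P K) (k + 1)) (hVk : Small expMeanLogSU Vk c) :
    ‖recordQtC F k K Vk z c‖ ≤ 1 := by
  have hb := (windows_of_oneStep F k K hk Vk z hs hφ hlam hε hκ hε50 c hVk).2
  rw [recordQtC_apply]
  exact (MatrixLog.norm_mlog_le_two_mul hb).trans (by linarith)

/-! ## §2  The radius `R = 1∕(10⁸·d·L)` -/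

/-- **THE RADIUS.**  If `‖z‖ ≤ 1∕(10⁸·d·L)` then with `s := e^{3‖z‖} − 1`: `(1+2s)^{dL} − 1 + (1+2s)^L − 1 ≤ 10⁻⁶` (Bernoulli∕exponential bounds; constants crude). [folklore] -/
theorem phi_add_lam_le_of_norm_le {d L : ℕ} (hd : 1 ≤ d) (hL : 1 ≤ L) {t : ℝ} (ht0 : 0 ≤ t) (ht : t ≤ 1 / (10 ^ 8 * d * L)) :
    ((1 + 2 * (Real.exp (3 * t) - 1)) ^ (d * L) - 1) + ((1 + 2 * (Real.exp (3 * t) - 1)) ^ L - 1) ≤ 1 / 10 ^ 6 := by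
  have hd' : (1 : ℝ) ≤ d := by exact_mod_cast hd
  have hL' : (1 : ℝ) ≤ L := by exact_mod_cast hL
  have hL0 : (0 : ℝ) ≤ L := by linarith
  have hdL : (L : ℝ) ≤ (d : ℝ) * L := le_mul_of_one_le_left hL0 hd'
  have hdLpos : (0 : ℝ) < 10 ^ 8 * d * L := by positivity
  -- `t·(10⁸ d L) ≤ 1`
  have htdL : t * (10 ^ 8 * d * L) ≤ 1 := by
    have := mul_le_mul_of_nonneg_right ht hdLpos.le
    rwa [div_mul_cancel₀ _ hdLpos.ne'] at this
  have hdLt : (d : ℝ) * L * t ≤ 1 / 10 ^ 8 := by nlinarith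
  have h3t : 3 * t ≤ 1 := by nlinarith
  -- `s ≤ 6 t`
  have hA : 0 ≤ Real.exp (3 * t) - 1 := by linarith [Real.add_one_le_exp (3 * t)]
  have hB : 0 ≤ 3 * t := by linarith
  have hs : Real.exp (3 * t) - 1 ≤ 6 * t := by
    have h := Real.abs_exp_sub_one_le (x := 3 * t) (by rw [abs_of_nonneg hB]; exact h3t)
    rw [abs_of_nonneg hA, abs_of_nonneg hB] at h
    linarith
  set a : ℝ := 2 * (Real.exp (3 * t) - 1) with ha
  have ha0 : 0 ≤ a := by rw [ha]; linarith
  have ha12 : a ≤ 12 * t := by rw [ha]; linarith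
  -- `(1+a)^n − 1 ≤ 2·n·a` when `n·a ≤ 1`
  have hpow : ∀ n : ℕ, (n : ℝ) * a ≤ 1 → (1 + a) ^ n - 1 ≤ 2 * ((n : ℝ) * a) := by
    intro n hn
    have hna : 0 ≤ (n : ℝ) * a := by positivity
    have h1 : (1 + a) ^ n ≤ Real.exp ((n : ℝ) * a) := by
      rw [Real.exp_nat_mul]
      exact pow_le_pow_left₀ (by linarith) (by linarith [Real.add_one_le_exp a]) n
    have hC : 0 ≤ Real.exp ((n : ℝ) * a) - 1 := by linarith [Real.add_one_le_exp ((n : ℝ) * a)]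
    have h2 := Real.abs_exp_sub_one_le (x := (n : ℝ) * a) (by rw [abs_of_nonneg hna]; exact hn)
    rw [abs_of_nonneg hC, abs_of_nonneg hna] at h2
    linarith
  have hdLa : ((d : ℝ) * L) * a ≤ 12 / 10 ^ 8 := by nlinarith
  have hLa : (L : ℝ) * a ≤ 12 / 10 ^ 8 := le_trans (mul_le_mul_of_nonneg_right hdL ha0) hdLa
  have e1 := hpow (d * L) (by push_cast; linarith)
  have e2 := hpow L (by linarith)
  push_cast at e1
  linarith

/-! ## §3  `QuadAnalytic (recordCtC F k K Vk) (2∕R²) R` -/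

/-- lit's `nonlin` of DEF-1's `recordQtC Vk` IS DEF-1's `recordCtC Vk` (`recordLQtC := fderiv ℂ (recordQtC Vk) 0` — definitional). [cite: Balaban1987RG1, p.267 (bookkeeping)] -/
theorem nonlin_recordQtC (k K : ℕ) (Vk : GaugeField (F.P K) k (SU 2)) : nonlin (recordQtC F k K Vk) = recordCtC F k K Vk := rfl

/-- `Q̃_ℂ(Vk; 0) = 0` as a function of the coarse bond (inside the (0.4) guard at every `c`). [cite: Balaban1987RG1, p.267] -/
theorem recordQtC_zero_fun (k K : ℕ) (Vk : GaugeField (F.P K) k (SU 2)) (hVk : ∀ c, Small expMeanLogSU Vk c) : recordQtC F k K Vk 0 = 0 :=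
  funext fun c => recordQtC_zero F k K Vk c (hVk c)

/-- The `s` of a point of the ball: `‖pertC Vk z b·(Vk b)⋆ − 1‖ ≤ e^{3‖z‖} − 1` (✓`norm_pertC_mul_star_sub_one_le`), and the two windows + the sup bound on the ball `‖z‖ < 1∕(10⁸dL)`.
[cite: Balaban1987RG1, (2.4) p.266, p.267] -/
theorem windows_of_norm_lt (k K : ℕ) (hk : k + 1 ≤ (F.P K).m + (F.P K).K) (Vk : GaugeField (F.P K) k (SU 2)) {ε : ℝ}
    (hε : ∀ (c : PBond (F.P K) (k + 1)) (i : Idx (F.P K)), ‖loopM (coeField Vk) c i - 1‖ ≤ ε) (hε50 : ε ≤ 1 / 50)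
    (hVk : ∀ c, Small expMeanLogSU Vk c) (z : FluctIdx F k K → ℂ) (hz : ‖z‖ < 1 / (10 ^ 8 * (F.P K).d * (F.P K).L)) (c : PBond (F.P K) (k + 1)) :
    (∀ i : Idx (F.P K), ‖loopMh (pertC F k K Vk z) c i - 1‖ < 1) ∧
      ‖avgMh (pertC F k K Vk z) c * star (((avOfRecord F 2 K k).avg Vk c : SU 2) : MatA 2) - 1‖ < 1 ∧ ‖recordQtC F k K Vk z c‖ ≤ 1 := by
  have hs : ∀ b, ‖pertC F k K Vk z b * star (Vk b : MatA 2) - 1‖ ≤ Real.exp (3 * ‖z‖) - 1 := norm_pertC_mul_star_sub_one_le F k K Vk z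
  have hsum := phi_add_lam_le_of_norm_le (F.P K).hd (F.P K).hL.2.le (norm_nonneg z) hz.le
  have hW := windows_of_oneStep F k K hk Vk z hs le_rfl le_rfl hε hsum hε50 c (hVk c)
  have hQ := norm_recordQtC_apply_le_one F k K hk Vk z hs le_rfl le_rfl hε hsum hε50 c (hVk c)
  have hε0 : 0 ≤ ε := (norm_nonneg _).trans (hε c (Classical.arbitrary _))
  refine ⟨fun i => (hW.1 i).trans_lt (by linarith [hsum]), hW.2.trans_lt (by norm_num), hQ⟩

/-- `Q̃_ℂ(Vk; ·)` is ℂ-differentiable on the ball `‖z‖ < 1∕(10⁸dL)`. [cite: Balaban1987RG1, p.267 («an analytic function of B»)] -/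
theorem differentiableOn_recordQtC_ball (k K : ℕ) (hk : k + 1 ≤ (F.P K).m + (F.P K).K) (Vk : GaugeField (F.P K) k (SU 2)) {ε : ℝ}
    (hε : ∀ (c : PBond (F.P K) (k + 1)) (i : Idx (F.P K)), ‖loopM (coeField Vk) c i - 1‖ ≤ ε) (hε50 : ε ≤ 1 / 50)
    (hVk : ∀ c, Small expMeanLogSU Vk c) :
    DifferentiableOn ℂ (recordQtC F k K Vk) (ball 0 (1 / (10 ^ 8 * (F.P K).d * (F.P K).L))) :=
  differentiableOn_recordQtC F k K Vk
    (fun z hz c i => (windows_of_norm_lt F k K hk Vk hε hε50 hVk z (mem_ball_zero_iff.1 hz) c).1 i)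
    (fun z hz c => (windows_of_norm_lt F k K hk Vk hε hε50 hVk z (mem_ball_zero_iff.1 hz) c).2.1)

/-- The sup bound on the ball: `‖Q̃_ℂ(Vk; z)‖ ≤ 1`. [cite: Balaban1987RG1, p.267] -/
theorem norm_recordQtC_le_one (k K : ℕ) (hk : k + 1 ≤ (F.P K).m + (F.P K).K) (Vk : GaugeField (F.P K) k (SU 2)) {ε : ℝ}
    (hε : ∀ (c : PBond (F.P K) (k + 1)) (i : Idx (F.P K)), ‖loopM (coeField Vk) c i - 1‖ ≤ ε) (hε50 : ε ≤ 1 / 50)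
    (hVk : ∀ c, Small expMeanLogSU Vk c) :
    ∀ z ∈ ball (0 : FluctIdx F k K → ℂ) (1 / (10 ^ 8 * (F.P K).d * (F.P K).L)), ‖recordQtC F k K Vk z‖ ≤ 1 := fun z hz =>
  (pi_norm_le_iff_of_nonneg zero_le_one).2 fun c => (windows_of_norm_lt F k K hk Vk hε hε50 hVk z (mem_ball_zero_iff.1 hz) c).2.2

/-- ★★★ **`QuadAnalytic (recordCtC F k K Vk) (2∕R²) R`, `R = 1∕(10⁸·d·L)` — THE ESTIMATE INPUT OF SOCKET (o1)** for every background in the (0.4) guard with loops within `1∕50` of `1`: the nonlinear part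
`C̃ = Q̃ − LQ̃` of the complexified constraint is bounded by `(2∕R²)‖z‖²` on `‖z‖ < R` (Cauchy, lit ✓`nonlin_sq_bound`) and ℂ-differentiable along every complex line there; `R` and `C₂ = 2∕R²` depend on `d, L`
ONLY (k-uniform: the one-step map is block-local and the estimates are PT-B's absolute one-step constants). [cite: Balaban1987RG1, p.267; Balaban1985Variational, (49)–(55) pp.285–286] -/
theorem quadAnalytic_recordCtC (k K : ℕ) (hk : k + 1 ≤ (F.P K).m + (F.P K).K) (Vk : GaugeField (F.P K) k (SU 2)) {ε : ℝ}
    (hε : ∀ (c : PBond (F.P K) (k + 1)) (i : Idx (F.P K)), ‖loopM (coeField Vk) c i - 1‖ ≤ ε) (hε50 : ε ≤ 1 / 50)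
    (hVk : ∀ c, Small expMeanLogSU Vk c) :
    QuadAnalytic (recordCtC F k K Vk) (2 * 1 / (1 / (10 ^ 8 * (F.P K).d * (F.P K).L)) ^ 2) (1 / (10 ^ 8 * (F.P K).d * (F.P K).L)) := by
  have hR : (0 : ℝ) < 1 / (10 ^ 8 * (F.P K).d * (F.P K).L) := by
    have hd : (1 : ℝ) ≤ (F.P K).d := by exact_mod_cast (F.P K).hd
    have hL : (1 : ℝ) ≤ (F.P K).L := by exact_mod_cast (F.P K).hL.2.le
    positivity
  have hQd := differentiableOn_recordQtC_ball F k K hk Vk hε hε50 hVk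
  have hquad := nonlin_sq_bound hR hQd (norm_recordQtC_le_one F k K hk Vk hε hε50 hVk) (recordQtC_zero_fun F k K Vk hVk)
  rw [nonlin_recordQtC] at hquad
  refine ⟨fun z hz => hquad z (mem_ball_zero_iff.2 hz), fun P Q => ?_⟩
  have hCd : DifferentiableOn ℂ (recordCtC F k K Vk) (ball 0 (1 / (10 ^ 8 * (F.P K).d * (F.P K).L))) := by
    have h : recordCtC F k K Vk = fun z => recordQtC F k K Vk z - recordLQtC F k K Vk z := rfl
    rw [h]
    exact hQd.sub (recordLQtC F k K Vk).differentiable.differentiableOn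
  have hline : Differentiable ℂ (fun ζ : ℂ => P + ζ • Q) := (differentiable_const P).add (differentiable_id.smul_const Q)
  exact hCd.comp hline.differentiableOn fun ζ hζ => mem_ball_zero_iff.2 hζ

end Summit.QuantumFields.YangMills.Theorems.BalabanUVNodesPortS1

end
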